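import Literature.NumberTheory.GaloisCohomology.Howard2004.DegreeTwoInertProofs
import Literature.NumberTheory.EllipticCurves.RingClassGalOverCardinalityUnits
import HarnessLib

/-!
# Howard 2004, Prop. 1.1.9 at an inert prime for EVERY imaginary quadratic `K` with `p ∤ #𝓞_K^×`:
# `H¹(K_λ, T) = H¹_f ⊕ H¹_tr` without the standing `d_K < −4` (proofs file)

Topic `NumberTheory/GaloisCohomology/Howard2004` (sequel to `InertTameGeneratorRingClassProofs` (the core
`isCompl_unramifiedSubgroup_transverseCondition_of_isImaginaryQuadratic`, inputs `hGexp`, `hGT`),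
`InertTransverseDecompositionProofs` / `InertTransverseCountOfDiscrProofs` / `DegreeTwoInertProofs` (the same results under
`d_K < −4`, where `#G_ℓ = ℓ + 1`), and `EllipticCurves/RingClassGalOverCardinalityUnits` (`#G_ℓ ∣ ℓ² − 1`,
`ℓ + 1 ∣ #G_ℓ · #𝓞_K^×` for every imaginary quadratic `K`)).  THEOREMS ONLY: no definition, no named fact, no instance,
no `sorry`.

SOURCE / WHY.  B. Howard, *The Heegner point Kolyvagin system*, Compositio Math. **140** (2004) = arXiv:1202.6340, §1.2
(p. 6 L84–92): «the maximal `p`-subextension of `K[ℓ]_λ/K_λ` (call it `L`) is a maximal totally tamely ramified abelian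
`p`-extension of `K_λ` whose Galois group is canonically identified with the `p`-Sylow subgroup of `G_ℓ`» — true exactly
when `p ∤ u_K = #𝓞_K^×/2` (`#Gal(K[ℓ]_λ/K_λ) = #G_ℓ = (ℓ + 1)/u_K`, Cox Thm. 7.24), i.e. for every `(p, d_K)` with `p` odd
except `(3, −3)` (cell `pub/bsd-print-x9`, REF-167 «How04-2.6.1@(3,−3)-units»; admissible upgrade (i) «prove degree
(ℓ+1)/u_K + p-Sylow under p ∤ u_K»).  Prop. 1.1.9 (p. 6 L17–25) = `IsCompl H¹_f H¹_tr` needs from `G_ℓ` only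
(a) every `g ∈ G_ℓ` has `g^{q_λ − 1} = 1` (`#G_ℓ ∣ ℓ² − 1 = q_λ − 1`, NO unit hypothesis) and (b) `#G_ℓ · T = 0`, which for a
`p`-primary `T` with `(ℓ + 1) · T = 0` follows from `ℓ + 1 ∣ #G_ℓ · #𝓞_K^×` and `p ∤ #𝓞_K^×`.  Here:

* §1 `nsmul_eq_zero_of_dvd_mul_of_coprime` (the arithmetic of (b));
  `natCard_ringClassGalOver_smul_eq_zero_of_not_dvd_card_units` (= `hGT`);
  `pow_residueFieldCard_sub_one_eq_one_of_mem_ringClassGalOver_of_isImaginaryQuadratic` (= `hGexp`, unconditional);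
  `not_dvd_card_units_of_discr_lt` (`d_K < −4`, `p` odd ⇒ `p ∤ #𝓞_K^× = 2`: the old hypothesis implies the new).
* §2 (inert `λ ∋ ℓ`) `exists_forall_pow_inv_mul_mem_localRingClassSubgroup_of_isImaginaryQuadratic` (`hcyc`, now for EVERY
  imaginary quadratic `K`); under `hu : ¬ p ∣ Nat.card (𝓞 K)ˣ`:
  **`isCompl_unramifiedSubgroup_transverseCondition_of_not_dvd_card_units`** (Prop. 1.1.9), `natCard_transverseCondition_eq_…`,
  `…_mul_eq_…`, `…_mul_eq_…'` (counts), `exists_transverse_submodule_isCompl_linearEquiv_of_not_dvd_card_units` (`R`-package).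
* §3 the same in the `IsDegreeTwo` / `transverseStructure` currency (`…_of_isDegreeTwo_of_not_dvd_card_units`).

NOT HERE: the `DVRSetting`-level twins (`DVRSettingEngineLocalInputsOfUnitsProofs`); `(p, d_K) = (3, −3)` (a genuine gap of
the printed §1.2); `thm161_dvrKolyvaginBound` is NOT proved; no summit statement is proved; BSD is not proved by any of this.
Seat `bsd-line-x9-p1-w3` g15, brick (HD-FREE).

References: [Howard2004HeegnerKolyvagin] §1.2, Prop. 1.1.9, Def. 1.2.2 (arXiv:1202.6340 p. 6 L17–25, L57–125);
[GrossLMS1991] §1 (PDF p. 212), §3 (PDF p. 217 l. 1–3); [Cox2013] §7.D Thm. 7.24.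
-/

set_option autoImplicit false

noncomputable section

open NumberField IsDedekindDomain IsDedekindDomain.HeightOneSpectrum Field

namespace Literature.NumberTheory.GaloisCohomology.Howard2004

open Literature.NumberTheory.GaloisRepresentations
open Literature.NumberTheory.GaloisRepresentations.DiscreteGaloisModule
open Literature.NumberTheory.GaloisRepresentations.IsNonarchimedeanLocalField
open Literature.NumberTheory.EllipticCurves
open Literature.NumberTheory.GaloisRepresentations.galoisCohomology

variable {K : Type} [Field K] [NumberField K]

/-! ## §1 `#G_ℓ · T = 0` from `ℓ + 1 ∣ #G_ℓ · #𝓞_K^×`, and `g^{q_λ−1} = 1` on `G_ℓ` -/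

/-- Arithmetic of the unit index: if `a · x = 0`, `a ∣ g·u`, `N · x = 0` and `gcd(N, u) = 1` then `g · x = 0`
(with `a = ℓ + 1`, `g = #G_ℓ`, `u = #𝓞_K^×`, `N = p^n`). [cite: Cox2013, §7.D Thm. 7.24 (the unit index [𝒪_K^× : 𝒪^×])] -/
theorem nsmul_eq_zero_of_dvd_mul_of_coprime {M : Type*} [AddCommGroup M] {x : M} {a g u N : ℕ}
    (ha : a • x = 0) (hdvd : a ∣ g * u) (hN : N • x = 0) (hcop : Nat.Coprime N u) : g • x = 0 := by
  obtain ⟨k, hk⟩ := hdvd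
  obtain ⟨s, t, hst⟩ := Nat.isCoprime_iff_coprime.mpr hcop.symm
  -- `x = (s u) · x` since `s u + t N = 1` and `N · x = 0`
  have hx : ((s * u : ℤ)) • x = x := by
    have h1 : ((s * u + t * N : ℤ)) • x = x := by rw [hst, one_zsmul]
    rwa [add_zsmul, mul_smul t, natCast_zsmul, hN, smul_zero, add_zero] at h1
  have hgu : ((g * u : ℕ) : ℤ) • x = 0 := by
    rw [natCast_zsmul, hk, mul_comm, mul_smul, ha, smul_zero]
  calc g • x = (g : ℤ) • ((s * u : ℤ) • x) := by rw [hx, natCast_zsmul]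
    _ = s • (((g * u : ℕ) : ℤ) • x) := by rw [smul_smul, smul_smul]; congr 1; push_cast; ring
    _ = 0 := by rw [hgu, smul_zero]

/-- **`#G_ℓ · T = 0`** for `G_ℓ = Gal(K[ℓ]/K[1])`, `K` any imaginary quadratic field, `ℓ` inert, `T` `p`-primary with
`(ℓ + 1) · T = 0` and **`p ∤ #𝓞_K^×`** (`ℓ + 1 ∣ #G_ℓ · #𝓞_K^×`): the input `hT` of
`isCompl_unramifiedSubgroup_transverseCondition_of_isImaginaryQuadratic`.
[cite: Howard2004HeegnerKolyvagin, §1.2 (arXiv:1202.6340 p. 6 L84–92)] [cite: Cox2013, §7.D Thm. 7.24] -/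
theorem natCard_ringClassGalOver_smul_eq_zero_of_not_dvd_card_units {M : Type*} [AddCommGroup M] (p : ℕ)
    [Fact p.Prime] (hK : IsImaginaryQuadratic K) (hu : ¬ p ∣ Nat.card (𝓞 K)ˣ) (ι : K →+* ℂ) {ℓ : ℕ}
    (hℓ : ℓ.Prime) (hℓP : (Ideal.span {(ℓ : 𝓞 K)}).IsPrime) (hp : ∀ x : M, ∃ n : ℕ, p ^ n • x = 0)
    (hℓT : ∀ x : M, (ℓ + 1) • x = 0) (x : M) : Nat.card (ringClassGalOver ι (ℓ * 1) 1) • x = 0 := by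
  obtain ⟨n, hn⟩ := hp x
  exact nsmul_eq_zero_of_dvd_mul_of_coprime (hℓT x)
    (RingClassField.succ_dvd_card_ringClassGalOver_mul_card_units hK ι hℓ hℓP) hn
    (Nat.Coprime.pow_left n ((Nat.Prime.coprime_iff_not_dvd Fact.out).mpr hu))

/-- **`g^{q_λ − 1} = 1` for every `g ∈ G_ℓ`**, `K` ANY imaginary quadratic field, `(ℓ)` inert, `λ ∋ ℓ` (`q_λ = ℓ²`,
`#G_ℓ ∣ ℓ² − 1`): the input `hGexp` of the Prop. 1.1.9 core, with no hypothesis on the units.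
[cite: Howard2004HeegnerKolyvagin, §1.2 (arXiv:1202.6340 p. 6 L84–92)] [cite: GrossLMS1991, §3 (PDF p. 217 l. 1–3)] -/
theorem pow_residueFieldCard_sub_one_eq_one_of_mem_ringClassGalOver_of_isImaginaryQuadratic
    (hK : IsImaginaryQuadratic K) (ι : K →+* ℂ) {ℓ : ℕ} (hℓ : ℓ.Prime) (hℓP : (Ideal.span {(ℓ : 𝓞 K)}).IsPrime)
    {v : HeightOneSpectrum (𝓞 K)} (hv : (ℓ : 𝓞 K) ∈ v.asIdeal)
    {g : ringClassField K ι (ℓ * 1) ≃ₐ[ℚ] ringClassField K ι (ℓ * 1)} (hg : g ∈ ringClassGalOver ι (ℓ * 1) 1) :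
    g ^ (residueFieldCard (v.adicCompletion K) - 1) = 1 := by
  rw [residueFieldCard_adicCompletion_eq_sq_of_inert hK.1 hℓ hℓP hv]
  exact RingClassField.pow_sq_sub_one_eq_one_of_mem_ringClassGalOver hK ι hℓ hℓP hg

/-- The old standing hypothesis implies the new one: for `d_K < −4` (`#𝓞_K^× = 2`) and `p` odd, `p ∤ #𝓞_K^×`.
[cite: GrossLMS1991, §1 (PDF p. 212: 𝒪^× = ⟨±1⟩ for D ≠ 3, 4)] -/
theorem not_dvd_card_units_of_discr_lt (hK : IsImaginaryQuadratic K) (hd : NumberField.discr K < -4) {p : ℕ}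
    (hp : p.Prime) (hp2 : p ≠ 2) : ¬ p ∣ Nat.card (𝓞 K)ˣ := by
  rw [card_units_eq_two_of_discr_lt hK hd]
  intro h
  exact hp2 ((Nat.prime_dvd_prime_iff_eq hp Nat.prime_two).mp h)

/-! ## §2 Prop. 1.1.9 at an inert `λ ∋ ℓ` under `p ∤ #𝓞_K^×` -/

section Inert

variable {M : Type} [AddCommGroup M] [TopologicalSpace M] [DiscreteTopology M]

/-- **`hcyc` at an inert prime for EVERY imaginary quadratic `K`**: some `σ₀ ∈ I_{K_λ}` (any tame generator) with
`Γ_{K_λ} = ⋃_j σ₀^j · (Γ_{K_λ} ∩ Γ_{K[ℓ]})` (`hGexp` being unconditional).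
[cite: Howard2004HeegnerKolyvagin, §1.2 (arXiv:1202.6340 p. 6 L84–95)] [cite: GrossLMS1991, §3 (PDF p. 217 l. 1–3)] -/
theorem exists_forall_pow_inv_mul_mem_localRingClassSubgroup_of_isImaginaryQuadratic (hK : IsImaginaryQuadratic K)
    (jbar : AlgebraicClosure K →+* ℂ) {ℓ : ℕ} (hℓ : ℓ.Prime) (hℓP : (Ideal.span {(ℓ : 𝓞 K)}).IsPrime)
    {v : HeightOneSpectrum (𝓞 K)} (hv : (ℓ : 𝓞 K) ∈ v.asIdeal) :
    ∃ σ₀ : absoluteGaloisGroup (v.adicCompletion K), σ₀ ∈ absInertia (v.adicCompletion K) ∧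
      ∀ σ : absoluteGaloisGroup (v.adicCompletion K), ∃ j : ℕ, (σ₀ ^ j)⁻¹ * σ ∈ localRingClassSubgroup ℓ jbar v := by
  obtain ⟨σ₀, hσ₀⟩ := exists_isTameGenerator (F := v.adicCompletion K)
  exact ⟨σ₀, σ₀.2, exists_pow_inv_mul_mem_localRingClassSubgroup_of_isTameGenerator hK jbar hℓ hℓP hv hσ₀
    fun _ hg => pow_residueFieldCard_sub_one_eq_one_of_mem_ringClassGalOver_of_isImaginaryQuadratic hK _ hℓ hℓP hv hg⟩

/-- **Howard Prop. 1.1.9, `H¹(K_λ, T) = H¹_f ⊕ H¹_tr`, for EVERY imaginary quadratic `K` with `p ∤ #𝓞_K^×`** (`(ℓ)`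
inert, `λ ∋ ℓ`, `T` finite `p`-primary with trivial `Γ_{K_λ}`-action and `(ℓ + 1) · T = 0`): the units hypothesis
`d_K < −4` of `isCompl_unramifiedSubgroup_transverseCondition_of_discr_lt` replaced by Howard's exact obstruction.
[cite: Howard2004HeegnerKolyvagin, Prop. 1.1.9 and §1.2 (arXiv:1202.6340 p. 6 L17–25, L84–92)] [cite: Cox2013, §7.D Thm. 7.24] -/
theorem isCompl_unramifiedSubgroup_transverseCondition_of_not_dvd_card_units [Finite M] (p : ℕ) [Fact p.Prime]
    (hK : IsImaginaryQuadratic K) (hu : ¬ p ∣ Nat.card (𝓞 K)ˣ) (ρ : DiscreteGaloisModule K M)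
    (jbar : AlgebraicClosure K →+* ℂ) {ℓ : ℕ} (hℓ : ℓ.Prime) (hℓP : (Ideal.span {(ℓ : 𝓞 K)}).IsPrime)
    {v : HeightOneSpectrum (𝓞 K)} (hv : (ℓ : 𝓞 K) ∈ v.asIdeal)
    (htriv : ∀ (g : absoluteGaloisGroup (v.adicCompletion K)) (x : M), GaloisRep.toLocal v ρ g x = x)
    (hp : ∀ x : M, ∃ n : ℕ, p ^ n • x = 0) (hℓT : ∀ x : M, (ℓ + 1) • x = 0) :
    IsCompl (DiscreteGaloisModule.unramifiedSubgroup (GaloisRep.toLocal v ρ) 1)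
      (transverseCondition p ρ ℓ jbar v) :=
  isCompl_unramifiedSubgroup_transverseCondition_of_isImaginaryQuadratic p hK ρ jbar hℓ hℓP hv htriv hp
    (residueFieldCard_sub_one_smul_eq_zero_of_succ_smul hK.1 hℓ hℓP hv hℓT)
    (fun _ hg =>
      pow_residueFieldCard_sub_one_eq_one_of_mem_ringClassGalOver_of_isImaginaryQuadratic hK _ hℓ hℓP hv hg)
    (natCard_ringClassGalOver_smul_eq_zero_of_not_dvd_card_units p hK hu _ hℓ hℓP hp hℓT)

/-- **`#H¹_tr(K_λ, T) = #T`** (same hypotheses). [cite: Howard2004HeegnerKolyvagin, Prop. 1.1.9 (arXiv:1202.6340 p. 6 L17–25)] -/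
theorem natCard_transverseCondition_eq_of_not_dvd_card_units [Finite M] (p : ℕ) [Fact p.Prime]
    (hK : IsImaginaryQuadratic K) (hu : ¬ p ∣ Nat.card (𝓞 K)ˣ) (ρ : DiscreteGaloisModule K M)
    (jbar : AlgebraicClosure K →+* ℂ) {ℓ : ℕ} (hℓ : ℓ.Prime) (hℓP : (Ideal.span {(ℓ : 𝓞 K)}).IsPrime)
    {v : HeightOneSpectrum (𝓞 K)} (hv : (ℓ : 𝓞 K) ∈ v.asIdeal)
    (htriv : ∀ (g : absoluteGaloisGroup (v.adicCompletion K)) (x : M), GaloisRep.toLocal v ρ g x = x)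
    (hp : ∀ x : M, ∃ n : ℕ, p ^ n • x = 0) (hℓT : ∀ x : M, (ℓ + 1) • x = 0) :
    Nat.card (transverseCondition p ρ ℓ jbar v) = Nat.card M :=
  natCard_eq_of_isCompl_unramifiedSubgroup (GaloisRep.toLocal v ρ) htriv
    (residueFieldCard_sub_one_smul_eq_zero_of_succ_smul hK.1 hℓ hℓP hv hℓT)
    (isCompl_unramifiedSubgroup_transverseCondition_of_not_dvd_card_units p hK hu ρ jbar hℓ hℓP hv htriv hp hℓT)

/-- **`#H¹_tr(K_λ, T) · #H¹_tr(K_λ', T) = #H¹(K_λ, T)`** for `λ, λ' ∋ ℓ` (the `hcard` of the isotropy-count criterion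
for H.4 at `λ ∣ n`), same hypotheses. [cite: Howard2004HeegnerKolyvagin, Prop. 1.1.9 and Lemma 1.5.6 (arXiv:1202.6340 p. 6 L17–25, p. 10 L86–88)] -/
theorem natCard_transverseCondition_mul_eq_of_not_dvd_card_units [Finite M] (p : ℕ) [Fact p.Prime]
    (hK : IsImaginaryQuadratic K) (hu : ¬ p ∣ Nat.card (𝓞 K)ˣ) (ρ : DiscreteGaloisModule K M)
    (jbar : AlgebraicClosure K →+* ℂ) {ℓ : ℕ} (hℓ : ℓ.Prime) (hℓP : (Ideal.span {(ℓ : 𝓞 K)}).IsPrime)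
    {v v' : HeightOneSpectrum (𝓞 K)} (hv : (ℓ : 𝓞 K) ∈ v.asIdeal) (hv' : (ℓ : 𝓞 K) ∈ v'.asIdeal)
    (htriv : ∀ (g : absoluteGaloisGroup (v.adicCompletion K)) (x : M), GaloisRep.toLocal v ρ g x = x)
    (htriv' : ∀ (g : absoluteGaloisGroup (v'.adicCompletion K)) (x : M), GaloisRep.toLocal v' ρ g x = x)
    (hp : ∀ x : M, ∃ n : ℕ, p ^ n • x = 0) (hℓT : ∀ x : M, (ℓ + 1) • x = 0) :
    Nat.card (transverseCondition p ρ ℓ jbar v) * Nat.card (transverseCondition p ρ ℓ jbar v') =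
      Nat.card (galoisCohomology (GaloisRep.toLocal v ρ) 1) := by
  rw [natCard_transverseCondition_eq_of_not_dvd_card_units p hK hu ρ jbar hℓ hℓP hv htriv hp hℓT,
    natCard_transverseCondition_eq_of_not_dvd_card_units p hK hu ρ jbar hℓ hℓP hv' htriv' hp hℓT,
    natCard_galoisCohomology_toLocal_one_eq_sq_of_succ_smul hK.1 ρ hℓ hℓP hv htriv hℓT, sq]

/-- The same count with the local module written `ρ.toLocal (Sum.inr v)`. [cite: Howard2004HeegnerKolyvagin, Prop. 1.1.9 and Lemma 1.5.6 (arXiv:1202.6340 p. 6 L17–25, p. 10 L86–88)] -/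
theorem natCard_transverseCondition_mul_eq_of_not_dvd_card_units' [Finite M] (p : ℕ) [Fact p.Prime]
    (hK : IsImaginaryQuadratic K) (hu : ¬ p ∣ Nat.card (𝓞 K)ˣ) (ρ : DiscreteGaloisModule K M)
    (jbar : AlgebraicClosure K →+* ℂ) {ℓ : ℕ} (hℓ : ℓ.Prime) (hℓP : (Ideal.span {(ℓ : 𝓞 K)}).IsPrime)
    {v v' : HeightOneSpectrum (𝓞 K)} (hv : (ℓ : 𝓞 K) ∈ v.asIdeal) (hv' : (ℓ : 𝓞 K) ∈ v'.asIdeal)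
    (htriv : ∀ (g : absoluteGaloisGroup (v.adicCompletion K)) (x : M), GaloisRep.toLocal v ρ g x = x)
    (htriv' : ∀ (g : absoluteGaloisGroup (v'.adicCompletion K)) (x : M), GaloisRep.toLocal v' ρ g x = x)
    (hp : ∀ x : M, ∃ n : ℕ, p ^ n • x = 0) (hℓT : ∀ x : M, (ℓ + 1) • x = 0) :
    Nat.card (transverseCondition p ρ ℓ jbar v) * Nat.card (transverseCondition p ρ ℓ jbar v') =
      Nat.card (galoisCohomology (ρ.toLocal (Sum.inr v)) 1) :=
  natCard_transverseCondition_mul_eq_of_not_dvd_card_units p hK hu ρ jbar hℓ hℓP hv hv' htriv htriv' hp hℓT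

/-- **Prop. 1.1.9 `R`-linearly for EVERY imaginary quadratic `K` with `p ∤ #𝓞_K^×`**: an `R`-submodule `V_tr` of
`H¹(K_λ, T)` with underlying subgroup `H¹_tr`, complementary to `H¹_f`, and `H¹_f ≃ₗ[R] T`, `V_tr ≃ₗ[R] T` (the inputs
`hc`, `ef`, `etr` of the Lagrangian transfer). [cite: Howard2004HeegnerKolyvagin, Prop. 1.1.9, §1.5 (arXiv:1202.6340 p. 6 L17–25, p. 9 L105–108)] -/
theorem exists_transverse_submodule_isCompl_linearEquiv_of_not_dvd_card_units [Finite M] {R : Type} [CommRing R]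
    [Module R M] (p : ℕ) [Fact p.Prime] (hK : IsImaginaryQuadratic K) (hu : ¬ p ∣ Nat.card (𝓞 K)ˣ)
    (ρ : DiscreteGaloisModule K M) (jbar : AlgebraicClosure K →+* ℂ) {ℓ : ℕ}
    (hℓ : ℓ.Prime) (hℓP : (Ideal.span {(ℓ : 𝓞 K)}).IsPrime) {v : HeightOneSpectrum (𝓞 K)}
    (hv : (ℓ : 𝓞 K) ∈ v.asIdeal)
    (hρv : DiscreteGaloisModule.IsScalarLinear R (GaloisRep.toLocal v ρ))
    (htriv : ∀ (g : absoluteGaloisGroup (v.adicCompletion K)) (x : M), GaloisRep.toLocal v ρ g x = x)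
    (hp : ∀ x : M, ∃ n : ℕ, p ^ n • x = 0) (hℓT : ∀ x : M, (ℓ + 1) • x = 0) :
    letI := galoisCohomology.moduleH1 (GaloisRep.toLocal v ρ) hρv
    ∃ Vtr : Submodule R (galoisCohomology (GaloisRep.toLocal v ρ) 1),
      Vtr.toAddSubgroup = transverseCondition p ρ ℓ jbar v ∧
      IsCompl (DiscreteGaloisModule.unramifiedSubmodule hρv) Vtr ∧
      Nonempty (↥(DiscreteGaloisModule.unramifiedSubmodule hρv) ≃ₗ[R] M) ∧
      Nonempty (↥Vtr ≃ₗ[R] M) := by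
  letI := galoisCohomology.moduleH1 (GaloisRep.toLocal v ρ) hρv
  have hq : ∀ x : M, (residueFieldCard (v.adicCompletion K) - 1) • x = 0 :=
    residueFieldCard_sub_one_smul_eq_zero_of_succ_smul hK.1 hℓ hℓP hv hℓT
  let Vtr : Submodule R (galoisCohomology (GaloisRep.toLocal v ρ) 1) :=
    galoisCohomology.submoduleOfStable hρv (transverseCondition p ρ ℓ jbar v)
      (fun r _ hx => resSubgroup_hom_scalarMapH1_eq_zero (ρ := GaloisRep.toLocal v ρ) hρv
        (transverseFixer p ℓ jbar v) r hx)
  have hVtr : Vtr.toAddSubgroup = transverseCondition p ρ ℓ jbar v := rfl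
  have hc : IsCompl (DiscreteGaloisModule.unramifiedSubmodule hρv) Vtr := by
    refine isCompl_submodule_of_isCompl _ _ ?_
    rw [DiscreteGaloisModule.toAddSubgroup_unramifiedSubmodule, hVtr]
    exact isCompl_unramifiedSubgroup_transverseCondition_of_not_dvd_card_units p hK hu ρ jbar hℓ hℓP hv htriv
      hp hℓT
  obtain ⟨φ, hφ⟩ := exists_isAbsArithFrob_holds (F := v.adicCompletion K)
  obtain ⟨ef, -⟩ := nonempty_unramifiedSubmodule_linearEquiv (GaloisRep.toLocal v ρ) htriv hρv
    (IsAbsArithFrob.isFrobPow_holds hφ)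
  obtain ⟨σ₀, hσ₀⟩ := exists_isTameGenerator (F := v.adicCompletion K)
  obtain ⟨etr⟩ := nonempty_linearEquiv_of_isCompl_unramifiedSubmodule (GaloisRep.toLocal v ρ) htriv hρv hσ₀
    hq Vtr hc
  exact ⟨Vtr, hVtr, hc, ⟨ef⟩, ⟨etr⟩⟩

end Inert

/-! ## §3 The same in the `IsDegreeTwo` / `transverseStructure` currency -/

section DegreeTwo

variable {M : Type} [AddCommGroup M] [TopologicalSpace M] [DiscreteTopology M]

/-- **Prop. 1.1.9 at a degree-two prime, every imaginary quadratic `K` with `p ∤ #𝓞_K^×`** (`transverseStructure`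
currency). [cite: Howard2004HeegnerKolyvagin, Prop. 1.1.9 and Def. 1.2.2 (arXiv:1202.6340 p. 6 L17–25, L96–101)] -/
theorem isCompl_unramifiedSubgroup_transverseStructure_of_isDegreeTwo_of_not_dvd_card_units [Finite M] (p : ℕ)
    [Fact p.Prime] (hK : IsImaginaryQuadratic K) (hu : ¬ p ∣ Nat.card (𝓞 K)ˣ) (ρ : DiscreteGaloisModule K M)
    (jbar : AlgebraicClosure K →+* ℂ) {v : HeightOneSpectrum (𝓞 K)} (hv : IsDegreeTwo v)
    (htriv : ∀ (g : absoluteGaloisGroup (v.adicCompletion K)) (x : M), GaloisRep.toLocal v ρ g x = x)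
    (hp : ∀ x : M, ∃ n : ℕ, p ^ n • x = 0) (hℓT : ∀ x : M, (residueChar v + 1) • x = 0) :
    IsCompl (DiscreteGaloisModule.unramifiedSubgroup (GaloisRep.toLocal v ρ) 1)
      (transverseStructure p ρ jbar (Sum.inr v)) :=
  isCompl_unramifiedSubgroup_transverseCondition_of_not_dvd_card_units p hK hu ρ jbar (prime_residueChar v)
    (isPrime_span_residueChar_of_isDegreeTwo hK.1 hv) (natCast_residueChar_mem_asIdeal v) htriv hp hℓT

/-- **`#H¹_tr(K_λ, T) · #H¹_tr(K_λ', T) = #H¹(K_λ, T)`** for a degree-two `λ` and `λ'` with the same residue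
characteristic (e.g. `λ' = σλ`), every imaginary quadratic `K` with `p ∤ #𝓞_K^×`.
[cite: Howard2004HeegnerKolyvagin, Prop. 1.1.9 and Lemma 1.5.6 (arXiv:1202.6340 p. 6 L17–25, p. 10 L86–88)] -/
theorem natCard_transverseStructure_mul_eq_of_isDegreeTwo_of_not_dvd_card_units [Finite M] (p : ℕ)
    [Fact p.Prime] (hK : IsImaginaryQuadratic K) (hu : ¬ p ∣ Nat.card (𝓞 K)ˣ) (ρ : DiscreteGaloisModule K M)
    (jbar : AlgebraicClosure K →+* ℂ) {v v' : HeightOneSpectrum (𝓞 K)} (hv : IsDegreeTwo v)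
    (hchar : residueChar v' = residueChar v)
    (htriv : ∀ (g : absoluteGaloisGroup (v.adicCompletion K)) (x : M), GaloisRep.toLocal v ρ g x = x)
    (htriv' : ∀ (g : absoluteGaloisGroup (v'.adicCompletion K)) (x : M), GaloisRep.toLocal v' ρ g x = x)
    (hp : ∀ x : M, ∃ n : ℕ, p ^ n • x = 0) (hℓT : ∀ x : M, (residueChar v + 1) • x = 0) :
    Nat.card (transverseStructure p ρ jbar (Sum.inr v)) * Nat.card (transverseStructure p ρ jbar (Sum.inr v')) =
      Nat.card (galoisCohomology (ρ.toLocal (Sum.inr v)) 1) := by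
  have hv'mem : ((residueChar v : ℕ) : 𝓞 K) ∈ v'.asIdeal := hchar ▸ natCast_residueChar_mem_asIdeal v'
  have h := natCard_transverseCondition_mul_eq_of_not_dvd_card_units' p hK hu ρ jbar (prime_residueChar v)
    (isPrime_span_residueChar_of_isDegreeTwo hK.1 hv) (natCast_residueChar_mem_asIdeal v) hv'mem htriv htriv'
    hp hℓT
  change Nat.card (transverseCondition p ρ (residueChar v) jbar v) *
      Nat.card (transverseCondition p ρ (residueChar v') jbar v') = _
  rw [hchar]
  exact h

/-- `hcyc` at a degree-two prime for every imaginary quadratic `K` (no discriminant hypothesis).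
[cite: Howard2004HeegnerKolyvagin, §1.2 (arXiv:1202.6340 p. 6 L84–95)] [cite: GrossLMS1991, §3 (PDF p. 217 l. 1–3)] -/
theorem exists_forall_pow_inv_mul_mem_localRingClassSubgroup_of_isDegreeTwo' (hK : IsImaginaryQuadratic K)
    (jbar : AlgebraicClosure K →+* ℂ) {v : HeightOneSpectrum (𝓞 K)} (hv : IsDegreeTwo v) :
    ∃ σ₀ : absoluteGaloisGroup (v.adicCompletion K), σ₀ ∈ absInertia (v.adicCompletion K) ∧
      ∀ σ : absoluteGaloisGroup (v.adicCompletion K), ∃ j : ℕ,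
        (σ₀ ^ j)⁻¹ * σ ∈ localRingClassSubgroup (residueChar v) jbar v :=
  exists_forall_pow_inv_mul_mem_localRingClassSubgroup_of_isImaginaryQuadratic hK jbar (prime_residueChar v)
    (isPrime_span_residueChar_of_isDegreeTwo hK.1 hv) (natCast_residueChar_mem_asIdeal v)

/-- **Prop. 1.1.9 `R`-linearly at a degree-two prime, every imaginary quadratic `K` with `p ∤ #𝓞_K^×`** (`hc`, `ef`,
`etr`). [cite: Howard2004HeegnerKolyvagin, Prop. 1.1.9, §1.5 (arXiv:1202.6340 p. 6 L17–25, p. 9 L105–108)] -/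
theorem exists_transverse_submodule_isCompl_linearEquiv_of_isDegreeTwo_of_not_dvd_card_units [Finite M]
    {R : Type} [CommRing R] [Module R M] (p : ℕ) [Fact p.Prime] (hK : IsImaginaryQuadratic K)
    (hu : ¬ p ∣ Nat.card (𝓞 K)ˣ) (ρ : DiscreteGaloisModule K M) (jbar : AlgebraicClosure K →+* ℂ)
    {v : HeightOneSpectrum (𝓞 K)} (hv : IsDegreeTwo v)
    (hρv : DiscreteGaloisModule.IsScalarLinear R (GaloisRep.toLocal v ρ))
    (htriv : ∀ (g : absoluteGaloisGroup (v.adicCompletion K)) (x : M), GaloisRep.toLocal v ρ g x = x)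
    (hp : ∀ x : M, ∃ n : ℕ, p ^ n • x = 0) (hℓT : ∀ x : M, (residueChar v + 1) • x = 0) :
    letI := galoisCohomology.moduleH1 (GaloisRep.toLocal v ρ) hρv
    ∃ Vtr : Submodule R (galoisCohomology (GaloisRep.toLocal v ρ) 1),
      Vtr.toAddSubgroup = transverseStructure p ρ jbar (Sum.inr v) ∧
      IsCompl (DiscreteGaloisModule.unramifiedSubmodule hρv) Vtr ∧
      Nonempty (↥(DiscreteGaloisModule.unramifiedSubmodule hρv) ≃ₗ[R] M) ∧
      Nonempty (↥Vtr ≃ₗ[R] M) :=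
  exists_transverse_submodule_isCompl_linearEquiv_of_not_dvd_card_units p hK hu ρ jbar (prime_residueChar v)
    (isPrime_span_residueChar_of_isDegreeTwo hK.1 hv) (natCast_residueChar_mem_asIdeal v) hρv htriv hp hℓT

end DegreeTwo

end Literature.NumberTheory.GaloisCohomology.Howard2004

end
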